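import Literature.Analysis.FluidPDE.Tao2016AveragedNS.SeedScaleTiming
import Literature.Analysis.FluidPDE.Tao2016AveragedNS.PseudoOrbitSmoothing
import HarnessLib

/-!
# The seed-scale question decided at `q = 6` for pseudo-orbits: Theorem 5.3 along every pseudo-orbit

Cell `pub-fluidc`, blueprint seat 1 (gen 14). HONEST FRAMING: low prior, high value-of-information
experiment on Tao's machine paradigm [Tao2016AveragedNS, §5.5]; NOT a claim that NS blows up.

The cell's typed seed-scale question `PseudoOrbitTransitionSeed q` (NegativeKickSharp.lean): does
every `δ`-PSEUDO-ORBIT (continuous on `[0,T]`, right-differentiable on `[0,T)`, sup-defect `≤ δ`,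
sup-norm `≤ 2`) of a member `delayCircuitWith K M ε` of the retuned family, issued `δ₀`-close to
Tao's datum (5.6), with `δ₀ + δT ≤ ε²e^{-M}/K^q`, end the cycle FIRED (tolerance `1/4` at every
`t ∈ [2,T]`)? Known: NO for `q ≤ 4` (`not_pseudoOrbitTransitionSeed_of_le_four`: a negative trigger
pre-load of size `2ε²e^{-M}/√M` stalls the gate); YES for `q ≥ 6` over DIFFERENTIABLE approximate
trajectories (`approxTrajectoryTransitionSeed_six`, SeedScaleTiming.lean — the seed-scale chain,
Theorem 5.3 along forced trajectories within `δ₀ + δT ≤ ε²e^{-M}/(8√M)`).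

This file removes the differentiability proviso: **`pseudoOrbitTransitionSeed_six`**, the question
HOLDS at `q = 6` (hence at every `q ≥ 6`) for genuine pseudo-orbits. Mechanism: the smoothing lemma
`IsPseudoOrbit.exists_smooth_approx` (PseudoOrbitSmoothing.lean) approximates a continuous
pseudo-orbit uniformly on `[0,T]` by differentiable approximate trajectories whose datum error,
defect and sup-norm exceed `δ₀, δ, 6/5` by an arbitrary `η > 0`; the chain's conclusion on `[2,T]`
(`approxTrajectory_fired_from_two`: `|ã - 1| ≤ 6K⁻²⁰`, modes `≤ 4K⁻¹⁰`) is a CLOSED condition, and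
any budget STRICTLY inside `ε²e^{-M}/(8√M)` leaves room for `η(1 + T)`; `η → 0`. The K-power budget
`ε²e^{-M}/K⁶` is strictly inside (`8√M ≤ 8K⁵ < K⁶`). Continuity of `Y` off `[0,T]` is WLOG
(`IsPseudoOrbit.exists_continuous`).

* `continuous_delayCircuitWith` — the member's field is continuous;
* `IsPseudoOrbit.norm_le_six_fifths` — a pseudo-orbit within a small budget stays in the sup-ball
  of radius `6/5` on `[0,T]` (energy drift);
* `IsPseudoOrbit.fired_from_two` — **Theorem 5.3 along every pseudo-orbit** with
  `δ₀ + δT < ε²e^{-M}/(8√M)`: fired on `[2,T]` (`6K⁻²⁰`, `4K⁻¹⁰`);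
* `seedBudget_pow_lt` — `ε²e^{-M}/K⁶ < ε²e^{-M}/(8√M)`;
* `pseudoOrbitTransitionSeed_six`, `pseudoOrbitTransitionSeed_of_six_le` — the cell question at
  `q ≥ 6`: TRUE; `pseudoOrbitTransitionSeed_iff_of_ne_five` — decided for every `q ≠ 5`
  (`q = 5` sits inside the factor-16 gap between the firing budget and the stall threshold).
-/

namespace Literature.Analysis.FluidPDE.Tao2016AveragedNS

open Real Set
open scoped NNReal

/-- The member's vector field is continuous (a polynomial map). [folklore] -/
theorem continuous_delayCircuitWith (K M ε : ℝ) : Continuous (delayCircuitWith K M ε) :=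
  (contDiff_delayCircuitWith K M ε (n := 0)).continuous

/-- On the admissible range, `8√M ≤ 8K⁵ < K⁶`: the K-power budget `ε²e^{-M}/K⁶` is STRICTLY below
the seed-scale budget `ε²e^{-M}/(8√M)` of the chain. [folklore] -/
theorem seedBudget_pow_lt {K M ε : ℝ} (hK : 2 * 20 ^ 42 * (Nat.factorial 42 : ℝ) + 16 ≤ K)
    (hML : 3000 * Real.log K ≤ M) (hMK : M ≤ K ^ 10) (hε : 0 < ε)
    (hεle : ε ≤ exp (-(10 * M)) / K ^ 100) :
    ε ^ 2 * exp (-M) / K ^ 6 < ε ^ 2 * exp (-M) / (8 * Real.sqrt M) := by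
  obtain ⟨-, -, -, -, -, -, -, h77, -⟩ := Ignition.ignition_params hK hML hMK hε hεle
  obtain ⟨hK16, -, -, -, -, -⟩ := negKick_params hK hML hMK hε hεle
  have hK0 : (0 : ℝ) < K := by linarith
  have hsM : Real.sqrt M ≤ K ^ 5 := by
    calc Real.sqrt M ≤ Real.sqrt (K ^ 10) := Real.sqrt_le_sqrt hMK
      _ = K ^ 5 := by rw [show K ^ 10 = (K ^ 5) ^ 2 by ring, Real.sqrt_sq (by positivity)]
  have hK5 : (0 : ℝ) < K ^ 5 := by positivity
  have h8 : 8 * Real.sqrt M < K ^ 6 := by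
    calc 8 * Real.sqrt M ≤ 8 * K ^ 5 := by linarith
      _ < K * K ^ 5 := by nlinarith
      _ = K ^ 6 := by ring
  exact div_lt_div_of_pos_left (by positivity) (by positivity) h8

section Member

variable {K M ε δ δ₀ T : ℝ} {Y : ℝ → Fin 5 → ℝ}

/-- **A pseudo-orbit within a small budget stays in the sup-ball of radius `6/5` on `[0,T]`**:
energy `≤ 1 + 7δ₀ + 20δT ≤ 36/25` (almost-conserved energy, `IsPseudoOrbit.abs_energy_sub_le`).
[cite: Tao2016AveragedNS, §5 (g-cancel)] -/
theorem IsPseudoOrbit.norm_le_six_fifths (hY : IsPseudoOrbit (delayCircuitWith K M ε) δ 2 T Y)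
    (hδ : 0 ≤ δ) (h0 : ‖Y 0 - delayInit‖ ≤ δ₀) (hδ₀ : δ₀ ≤ 1 / 50) (hδT : δ * T ≤ 1 / 100) :
    ∀ t ∈ Icc 0 T, ‖Y t‖ ≤ 6 / 5 := by
  intro t ht
  have hE0 := abs_le.1 (Ignition.abs_energy_init_le h0 (by linarith))
  have hEt := abs_le.1 (hY.abs_energy_sub_le ht)
  have h20 : 20 * δ * t ≤ 20 * (δ * T) := by nlinarith [ht.1, ht.2]
  have hE : energy (Y t) ≤ (6 / 5) ^ 2 := by nlinarith
  rw [pi_norm_le_iff_of_nonneg (by norm_num)]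
  intro i
  rw [Real.norm_eq_abs]
  exact abs_le_of_sq_le_sq ((Ignition.sq_le_energy (Y t) i).trans hE) (by norm_num)

/-- **Theorem 5.3 along every pseudo-orbit within the seed-scale budget (open form).** Let `Y` be a
`δ`-pseudo-orbit of a member `delayCircuitWith K M ε` in the sup-ball of radius `2` on `[0,T]`
(`T ≥ 2`; continuous on `[0,T]`, RIGHT-differentiable on `[0,T)`), issued `δ₀`-close to (5.6), with
`δ₀ + δT < ε²e^{-M}/(8√M)` (strict). Then the gate is FIRED on all of `[2,T]`: `|ã - 1| ≤ 6K⁻²⁰` and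
`|a|, |b|, |c|, |d| ≤ 4K⁻¹⁰`. Proof: WLOG `Y` globally continuous; for `η → 0` the smoothing lemma
gives differentiable approximate trajectories within the chain's budget, to which
`approxTrajectory_fired_from_two` applies; the conclusion is closed.
[cite: Tao2016AveragedNS, §5.5 Theorem 5.3] -/
theorem IsPseudoOrbit.fired_from_two (hY : IsPseudoOrbit (delayCircuitWith K M ε) δ 2 T Y)
    (hK : 2 * 20 ^ 42 * (Nat.factorial 42 : ℝ) + 16 ≤ K) (hML : 3000 * Real.log K ≤ M)
    (hMK : M ≤ K ^ 10) (hε : 0 < ε) (hεle : ε ≤ exp (-(10 * M)) / K ^ 100) (hT : 2 ≤ T)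
    (h0 : ‖Y 0 - delayInit‖ ≤ δ₀) (hB : δ₀ + δ * T < ε ^ 2 * exp (-M) / (8 * Real.sqrt M)) :
    ∀ t ∈ Icc 2 T, |Y t 4 - 1| ≤ 6 / K ^ 20 ∧ ∀ i : Fin 5, i ≠ 4 → |Y t i| ≤ 4 / K ^ 10 := by
  -- parameter facts
  obtain ⟨-, hε1, hε2, hexpM, -, -, -, h77, -⟩ := Ignition.ignition_params hK hML hMK hε hεle
  have hT0 : 0 < T := by linarith
  have hδ : 0 ≤ δ := by
    obtain ⟨V, -, hV⟩ := hY.defect 0 ⟨le_rfl, hT0⟩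
    exact (norm_nonneg _).trans hV
  have hδ₀ : 0 ≤ δ₀ := (norm_nonneg _).trans h0
  have hδT : 0 ≤ δ * T := by positivity
  have hs0 : 0 < ε ^ 2 * exp (-M) := by positivity
  have hb8 : ε ^ 2 * exp (-M) / (8 * Real.sqrt M) ≤ 1 / 100 := by
    have h1 : ε ^ 2 * exp (-M) / (8 * Real.sqrt M) ≤ ε ^ 2 * exp (-M) :=
      div_le_self hs0.le (by linarith)
    have h2 : ε ^ 2 * exp (-M) ≤ ε ^ 2 * 1 := by gcongr; linarith
    linarith
  -- WLOG `Y` is globally continuous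
  obtain ⟨Yc, hYcc, hYcY, hYc⟩ := hY.exists_continuous hT0.le
  have h0c : ‖Yc 0 - delayInit‖ ≤ δ₀ := by rw [hYcY ⟨le_rfl, hT0.le⟩]; exact h0
  have hR₀ : ∀ t ∈ Icc 0 T, ‖Yc t‖ ≤ 6 / 5 :=
    hYc.norm_le_six_fifths hδ h0c (by linarith) (by linarith)
  have hF : Continuous (delayCircuitWith K M ε) := continuous_delayCircuitWith K M ε
  -- the slack
  obtain ⟨η₀, hη₀⟩ : ∃ η₀ : ℝ,
      η₀ = (ε ^ 2 * exp (-M) / (8 * Real.sqrt M) - (δ₀ + δ * T)) / (1 + T) := ⟨_, rfl⟩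
  have hη₀pos : 0 < η₀ := by rw [hη₀]; exact div_pos (by linarith) (by linarith)
  have hη₀T : η₀ * (1 + T) = ε ^ 2 * exp (-M) / (8 * Real.sqrt M) - (δ₀ + δ * T) := by
    rw [hη₀]; field_simp
  intro t ht
  have htT : t ∈ Icc 0 T := ⟨by linarith [ht.1], ht.2⟩
  -- the bounds with an extra `η`, for every `η > 0`
  have key : ∀ η : ℝ, 0 < η →
      |Yc t 4 - 1| ≤ 6 / K ^ 20 + η ∧ ∀ i : Fin 5, i ≠ 4 → |Yc t i| ≤ 4 / K ^ 10 + η := by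
    intro η hη
    obtain ⟨η', hη'⟩ : ∃ η' : ℝ, η' = min η (min η₀ (1 / 2)) := ⟨_, rfl⟩
    have hη'0 : 0 < η' := by rw [hη']; exact lt_min hη (lt_min hη₀pos (by norm_num))
    have hη'η : η' ≤ η := by rw [hη']; exact min_le_left _ _
    have hη'η₀ : η' ≤ η₀ := by rw [hη']; exact (min_le_right _ _).trans (min_le_left _ _)
    have hη'2 : η' ≤ 1 / 2 := by rw [hη']; exact (min_le_right _ _).trans (min_le_right _ _)
    obtain ⟨Z, W, hZd, hWd, hZn, hZY⟩ := hYc.exists_smooth_approx hF hYcc hT0 hR₀ hη'0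
    have hR : ∀ s ∈ Ico 0 T, ‖Z s‖ ≤ 2 := fun s hs =>
      (hZn s ⟨hs.1, hs.2.le⟩).trans (by linarith)
    have h0' : ‖Z 0 - delayInit‖ ≤ δ₀ + η' := by
      calc ‖Z 0 - delayInit‖ = ‖(Z 0 - Yc 0) + (Yc 0 - delayInit)‖ := by rw [sub_add_sub_cancel]
        _ ≤ ‖Z 0 - Yc 0‖ + ‖Yc 0 - delayInit‖ := norm_add_le _ _
        _ ≤ δ₀ + η' := by linarith [hZY 0 ⟨le_rfl, hT0.le⟩]
    have hB' : (δ₀ + η') + (δ + η') * T ≤ ε ^ 2 * exp (-M) / (8 * Real.sqrt M) := by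
      have h1 : η' * (1 + T) ≤ η₀ * (1 + T) := mul_le_mul_of_nonneg_right hη'η₀ (by linarith)
      nlinarith
    obtain ⟨he, hi⟩ := approxTrajectory_fired_from_two K M ε (δ + η') (δ₀ + η') T Z W hK hML hMK
      hε hεle hT hZd hWd hR h0' hB' t ht
    have hcoord : ∀ i, |Z t i - Yc t i| ≤ η' := fun i => by
      have h1 := norm_le_pi_norm (Z t - Yc t) i
      rw [Pi.sub_apply, Real.norm_eq_abs] at h1
      exact h1.trans (hZY t htT)
    refine ⟨?_, fun i hi4 => ?_⟩
    · have h1 := abs_le.1 (hcoord 4)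
      have h2 := abs_le.1 he
      rw [abs_le]; constructor <;> linarith
    · have h1 := abs_le.1 (hcoord i)
      have h2 := abs_le.1 (hi i hi4)
      rw [abs_le]; constructor <;> linarith
  rw [← hYcY htT]
  exact ⟨le_of_forall_pos_le_add fun η hη => (key η hη).1,
    fun i hi => le_of_forall_pos_le_add fun η hη => (key η hη).2 i hi⟩

end Member

/-- **The cell's seed-scale question holds at `q = 6` for pseudo-orbits.** For every member of the
retuned family and every `δ`-pseudo-orbit in the sup-ball of radius `2` on `[0,T]` (`T ≥ 2`) issued
`δ₀`-close to (5.6) with `δ₀ + δT ≤ ε²e^{-M}/K⁶`, the gate is fired with tolerance `1/4` at every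
`t ∈ [2,T]`. With `not_pseudoOrbitTransitionSeed_of_le_four` (NO for `q ≤ 4`) this decides the typed
question for every `q ≠ 5`. [cite: Tao2016AveragedNS, §5.5 Theorem 5.3] -/
theorem pseudoOrbitTransitionSeed_six : PseudoOrbitTransitionSeed 6 := by
  intro K M ε δ δ₀ T Y hK hML hMK hε hεle hT hδ₀ hδ hY h0 hB t ht
  obtain ⟨hK16, -, -, -, -, -⟩ := negKick_params hK hML hMK hε hεle
  have hK1 : (1 : ℝ) ≤ K := by linarith
  have h20 : (256 : ℝ) ≤ K ^ 20 :=
    le_trans (by nlinarith) (pow_le_pow_right₀ hK1 (by norm_num : 2 ≤ 20))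
  have h10 : (16 : ℝ) ≤ K ^ 10 := le_trans hK16 (le_self_pow₀ hK1 (by norm_num))
  have h6 : (6 : ℝ) / K ^ 20 ≤ 1 / 4 := by rw [div_le_iff₀ (by positivity)]; linarith
  have h4 : (4 : ℝ) / K ^ 10 ≤ 1 / 4 := by rw [div_le_iff₀ (by positivity)]; linarith
  obtain ⟨he, hi⟩ := hY.fired_from_two hK hML hMK hε hεle hT h0
    (hB.trans_lt (seedBudget_pow_lt hK hML hMK hε hεle)) t ht
  exact ⟨he.trans h6, fun i hi' => (hi i hi').trans h4⟩

/-- Hence the seed-scale question holds for every `q ≥ 6`. [cite: Tao2016AveragedNS, §5.5 Theorem 5.3] -/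
theorem pseudoOrbitTransitionSeed_of_six_le {q : ℕ} (hq : 6 ≤ q) : PseudoOrbitTransitionSeed q :=
  pseudoOrbitTransitionSeed_six.mono hq

/-- **The seed-scale question is decided for every `q ≠ 5`**: it holds iff `q ≥ 6` (NO for `q ≤ 4`
by the sharp negative-kick dud, YES for `q ≥ 6` by Theorem 5.3 along pseudo-orbits). The exponent
`q = 5` sits inside the factor-16 gap between the firing budget `ε²e^{-M}/(8√M)` and the stall
threshold `2ε²e^{-M}/√M` and is not decided here. [cite: Tao2016AveragedNS, §5.5 Theorem 5.3] -/
theorem pseudoOrbitTransitionSeed_iff_of_ne_five {q : ℕ} (hq : q ≠ 5) :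
    PseudoOrbitTransitionSeed q ↔ 6 ≤ q := by
  constructor
  · intro h
    by_contra hlt
    exact not_pseudoOrbitTransitionSeed_of_le_four (q := q) (by omega) h
  · exact pseudoOrbitTransitionSeed_of_six_le

end Literature.Analysis.FluidPDE.Tao2016AveragedNS
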